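import Summits.BirchSwinnertonDyer.BirchSwinnertonDyer.Theorems.ClassRecordThreeHalvesAtThreeValueContinuity
import Summits.BirchSwinnertonDyer.BirchSwinnertonDyer.Theorems.ClassRecordThreeAssembly
import Summits.BirchSwinnertonDyer.Rank1Residual.X11b.UnrIntegersValuationRing
import Summits.BirchSwinnertonDyer.Rank1Residual.X11b.PadicComplexInertiaFixed
import HarnessLib

/-!
# Route `ClassRecordThree`, crux `HalvesAtThree` (item stmt-BirchSwinnertonDyer-19107) — the crux over the
# route's new by-name LEAVES `BDPValueLeafAtThree` (19406) ∕ `IMCDivLeafAtThree` (19407) ∕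
# `HsiehDescentLeafAtThree` (19405), and H2@3 as ONE 3-adic valuation per frame

Cell `bsd-stepL` (run/shared/lean/pub/bsd-stepL/), seat `bsd-stepL-thmc-p1` (prover g3, D-0074 hands, 2026-08-26),
`--supports stmt-BirchSwinnertonDyer-19107`. Sequel to `Theorems/ClassRecordThreeHalvesAtThreeBDPValue.lean` (g0:
H2 ⟸ THEOREM C typed; the crux in locus form) and `Theorems/ClassRecordThreeHalvesAtThreeValueContinuity.lean`
(g2: H2 ⟸ value continuity at `𝟙`, (VC₃)). Route rev 6 (planner g24) states the three `@[conjecture]` leaves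
`Three.HsiehDescentAt₃ ∕ BDPValueAt₃ ∕ IMCDivAt₃` on all of X11b@3 as the by-name ASIDE items 19405 ∕ 19406 ∕ 19407.

## What this file records in the kernel

1. **The crux over the leaves.** `HalvesAtThree` ⟸ `BDPValueLeafAtThree ∧ IMCDivLeafAtThree`
   (`classRecordThree_halvesAtThree_of_leaves`), and ⟸ `BDPValueLeafAtThree` ∧ the registered H3 stub
   `stub_imcDivAtThree` (`classRecordThree_halvesAtThree_of_bdpValueLeaf_of_imcDivStub`). Conversely the two
   leaves are EXACTLY the crux plus both halves on the one X11b@3 atom the crux omits — (ram) ∧ non-split(3) ∧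
   surj, road (a)'s (`classRecordThree_leaves_iff_halvesAtThree_and_roadA`); each leaf is its surjective form
   (`classRecordThree_bdpValueLeafAtThree_iff`, `classRecordThree_imcDivLeafAtThree_iff`: both predicates bind
   `Surj W 3` inside). So whoever closes item 19406 — by any road — closes the H2 conjuncts of 19107 BY NAME.
2. **The H2 leaf from the two certified H2 currencies**: ⟸ (VC₃) for every curve
   (`classRecordThree_bdpValueLeafAtThree_of_valueContinuity`, g2's hypothesis verbatim) and ⟸ THEOREM C typed
   (`classRecordThree_bdpValueLeafAtThree_of_classicalFrameValue`, g0's hypothesis verbatim).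
3. **The route's Assembly over the three leaves** (`classRecordThree_closes_of_leaves`): `SchneiderAtThree →
   HsiehDescentLeafAtThree → BDPValueLeafAtThree → IMCDivLeafAtThree → EulerHalvesAtThree → ShimuraDisplaysAtThree
   → CornerAtThree → PublishedInputsThree → X11b.MultiplicativeRankOneAtThree`, through the route's CLOSED
   `Assembly` ITEM (`classRecordThree_assembly_holds`, item 19113 — a frozen signature), NOT through the
   gate-rendered `ClassRecordThree.closes` (whose binder list changes with every route edit; cell rule RULING 24).
4. **H2@3 is ONE 3-adic valuation per frame** (`bdpValueAt₃_iff_norm_constantCoeff`): the unit `u ∈ R₀ˣ` of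
   Castella's Thm. 3.2 shape carries no information beyond the valuation — `Three.BDPValueAt₃ W` is EQUIVALENT to
   «for every frame `(ι', Ω_K, Ω_p, L)`, `‖[T⁰]L‖ = ‖(1 − a₃(E)·3⁻¹)·log_{ω_E} P‖²`», i.e.
   `ord₃ L(𝟙) = 2·ord₃ log_{ω_E} P − 2`, because `[T⁰]L ∈ R₀`, the target lies in `ℚ₃ ⊆ Frac R₀`, and `R₀` is
   the valuation ring of `Frac R₀` (`R1.mem_unrIntegers_of_mem_fracUnr`, `unrIntegers.isUnit_iff_norm_eq_one`).
   The general lemma is `UnrSeries.exists_unit_hasValueAt_zero_iff_norm_eq`. This is the quantity the cell's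
   STEP-0-H2 numerics measure (PROOF-BDP §20.6; planner CONTROL kit j240166 ∕ j240696).

HONEST FRAMING: every theorem here is an implication, an equivalence, or by-name glue; nothing is discharged —
`Three.BDPValueAt₃` (memo THEOREM C, refereed; kernel form = Katz-measure ∕ Igusa-tower ∕ Coleman definition
front, out of tranche by (R-b)) and `Three.IMCDivAt₃` (open at `p = 3`) stay OPEN; no node, label or census
count moves (T7); BSD(E,3) is proved for no class by this file.

References: [Castella2018] Camb. J. Math. 6 (2018) = arXiv:1704.06608, Thm. 3.1–3.2 (pp. 8–9), §5 (p. 12); cell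
memo PROOF-BDP v1.8 §20 (THEOREM C; §20.6 STEP-0-H2); `Theses/ClassRecordThree.lean` rev 6 (asides 19405–19407).
-/

noncomputable section

open scoped Classical Topology

open Filter WeierstrassCurve NumberField IsDedekindDomain Field PowerSeries
  Literature.NumberTheory.EllipticCurves Literature.NumberTheory.EllipticCurves.ModularForms
  Literature.NumberTheory.EllipticCurves.Rank1Residual
  Literature.NumberTheory.GaloisRepresentations Literature.NumberTheory.GaloisCohomology
  Summit.BirchSwinnertonDyer.Rank1Residual Summit.BirchSwinnertonDyer.Rank1Residual.X11b
  Summit.BirchSwinnertonDyer.Rank1Residual.X11b.AcSelmer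
  Summit.BirchSwinnertonDyer.Rank1Residual.X11b.CongruenceLimit
  Summit.BirchSwinnertonDyer.Rank1Residual.X11b.Halves
  Summit.BirchSwinnertonDyer.Rank1Residual.X11b.Three
  Summit.BirchSwinnertonDyer.BirchSwinnertonDyer.Theses.ClassRecordThree

namespace Summit.BirchSwinnertonDyer.BirchSwinnertonDyer.Theorems

/-! ## §1 The crux `HalvesAtThree` over the by-name leaves of route rev 6 -/

/-- **The H2 leaf is its surjective form**: `BDPValueLeafAtThree` (H2 for every X11b@3 curve) is equivalent to
H2 for every X11b@3 curve with surjective mod-3 image, since `Three.BDPValueAt₃ W` binds `Surj W 3` inside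
(`bdpValueAt₃_of_not_surj`). [folklore] -/
theorem classRecordThree_bdpValueLeafAtThree_iff :
    BDPValueLeafAtThree ↔
      ∀ (W : WeierstrassCurve ℚ) [W.IsElliptic] [W.IsGloballyMinimal], ClassX11b W 3 → Surj W 3 →
        BDPValueAt₃ W := by
  unfold BDPValueLeafAtThree
  refine ⟨fun h W _ _ hX _ ↦ h W hX, fun h W _ _ hX ↦ ?_⟩
  by_cases hsurj : Surj W 3
  · exact h W hX hsurj
  · exact bdpValueAt₃_of_not_surj W hsurj

/-- **The H3 leaf is its surjective form**: `IMCDivLeafAtThree` is equivalent to H3 for every X11b@3 curve with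
surjective mod-3 image (`Three.IMCDivAt₃ W` binds `Surj W 3` inside, `imcDivAt₃_of_not_surj`). [folklore] -/
theorem classRecordThree_imcDivLeafAtThree_iff :
    IMCDivLeafAtThree ↔
      ∀ (W : WeierstrassCurve ℚ) [W.IsElliptic] [W.IsGloballyMinimal], ClassX11b W 3 → Surj W 3 →
        IMCDivAt₃ W := by
  unfold IMCDivLeafAtThree
  refine ⟨fun h W _ _ hX _ ↦ h W hX, fun h W _ _ hX ↦ ?_⟩
  by_cases hsurj : Surj W 3
  · exact h W hX hsurj
  · exact imcDivAt₃_of_not_surj W hsurj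

/-- **The crux from the two leaves**: `BDPValueLeafAtThree` (item 19406) and `IMCDivLeafAtThree` (item 19407)
give `HalvesAtThree` (item 19107) — the loci binders of the crux are simply dropped. [folklore] -/
theorem classRecordThree_halvesAtThree_of_leaves (h2 : BDPValueLeafAtThree) (h3 : IMCDivLeafAtThree) :
    HalvesAtThree := by
  unfold HalvesAtThree
  intro W _ _ hX
  exact ⟨fun _ _ ↦ ⟨h2 W hX, h3 W hX⟩, fun _ _ ↦ ⟨h2 W hX, h3 W hX⟩⟩

/-- **The crux from the H2 leaf and the registered H3 stub**: `BDPValueLeafAtThree` (item 19406) and the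
two-loci H3 statement — verbatim the registered stub `stub_imcDivAtThree` of the item's BC3 skeleton v2 ((ram) →
3 split → `IMCDivAt₃ W`; ¬(ram) → surj → `IMCDivAt₃ W`) — give `HalvesAtThree`. H3 is OPEN; nothing discharged.
[cite: Castella2018, Thm. 3.3 (arXiv:1704.06608 p. 9) (shape of H3 only; open at p = 3)] -/
theorem classRecordThree_halvesAtThree_of_bdpValueLeaf_of_imcDivStub (h2 : BDPValueLeafAtThree)
    (h3 : ∀ (W : WeierstrassCurve ℚ) [W.IsElliptic] [W.IsGloballyMinimal], ClassX11b W 3 →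
      (Ram W 3 → W.HasSplitMultiplicativeReductionAtPrime 3 → IMCDivAt₃ W) ∧
        (¬ Ram W 3 → Surj W 3 → IMCDivAt₃ W)) :
    HalvesAtThree := by
  unfold HalvesAtThree
  intro W _ _ hX
  obtain ⟨hI₁, hI₂⟩ := h3 W hX
  exact ⟨fun hr hs ↦ ⟨h2 W hX, hI₁ hr hs⟩, fun hnr hsu ↦ ⟨h2 W hX, hI₂ hnr hsu⟩⟩

/-- **What the leaves add to the crux, exactly**: the pair of leaves (`BDPValueLeafAtThree`, `IMCDivLeafAtThree`)
is EQUIVALENT to `HalvesAtThree` together with both halves on the one X11b@3 atom the crux leaves out — a (ram)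
witness, NON-split multiplicative reduction at 3, surjective image (road (a)'s population, crux
`SchneiderAtThree`) — by the locus form `classRecordThree_halvesAtThree_iff`. [folklore] -/
theorem classRecordThree_leaves_iff_halvesAtThree_and_roadA :
    (BDPValueLeafAtThree ∧ IMCDivLeafAtThree) ↔
      HalvesAtThree ∧
        ∀ (W : WeierstrassCurve ℚ) [W.IsElliptic] [W.IsGloballyMinimal], ClassX11b W 3 → Surj W 3 →
          Ram W 3 → ¬ W.HasSplitMultiplicativeReductionAtPrime 3 → BDPValueAt₃ W ∧ IMCDivAt₃ W := by
  constructor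
  · rintro ⟨h2, h3⟩
    exact ⟨classRecordThree_halvesAtThree_of_leaves h2 h3, fun W _ _ hX _ _ _ ↦ ⟨h2 W hX, h3 W hX⟩⟩
  · rintro ⟨h, hA⟩
    have key : ∀ (W : WeierstrassCurve ℚ) [W.IsElliptic] [W.IsGloballyMinimal], ClassX11b W 3 → Surj W 3 →
        BDPValueAt₃ W ∧ IMCDivAt₃ W := by
      intro W _ _ hX hsurj
      by_cases hloc : Ram W 3 ∧ ¬ W.HasSplitMultiplicativeReductionAtPrime 3
      · exact hA W hX hsurj hloc.1 hloc.2
      · exact classRecordThree_halvesAtThree_iff.mp h W hX hsurj hloc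
    exact ⟨classRecordThree_bdpValueLeafAtThree_iff.mpr fun W _ _ hX hsurj ↦ (key W hX hsurj).1,
      classRecordThree_imcDivLeafAtThree_iff.mpr fun W _ _ hX hsurj ↦ (key W hX hsurj).2⟩

/-- **`HsiehDescentAtThree` (crux 19108) from its leaf** `HsiehDescentLeafAtThree` (item 19405): the loci
binders are dropped. [folklore] -/
theorem classRecordThree_hsiehDescentAtThree_of_leaf (h : HsiehDescentLeafAtThree) : HsiehDescentAtThree := by
  unfold HsiehDescentAtThree
  intro W _ _ hX
  exact ⟨fun _ _ ↦ h W hX, fun _ _ ↦ h W hX⟩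

/-- **The route's Assembly over the three leaves**: with the cruxes `SchneiderAtThree`, `EulerHalvesAtThree`,
`ShimuraDisplaysAtThree`, `CornerAtThree`, the support `PublishedInputsThree`, and the three by-name leaves
`HsiehDescentLeafAtThree` (19405), `BDPValueLeafAtThree` (19406), `IMCDivLeafAtThree` (19407) in place of the
cruxes `HalvesAtThree` ∕ `HsiehDescentAtThree`, the rung-K2@3 leaf `X11b.MultiplicativeRankOneAtThree` follows, by
the route's closed `Assembly` item (`classRecordThree_assembly_holds`, 19113; formerly through the gate-rendered
`closes`, whose binder currency of 2026-08-26 is obsolete — BUILDFIX RULING 24). CONDITIONAL on every listed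
hypothesis; closes nothing by itself.
[cite: Castella2018, §5 (arXiv:1704.06608 p. 12) (assembly shape at p ∣ N; inputs typed, not asserted)] -/
theorem classRecordThree_closes_of_leaves (h₁ : SchneiderAtThree) (hD : HsiehDescentLeafAtThree)
    (h2 : BDPValueLeafAtThree) (h3 : IMCDivLeafAtThree) (h₄ : EulerHalvesAtThree) (h₅ : ShimuraDisplaysAtThree)
    (h₆ : CornerAtThree) (h₇ : PublishedInputsThree) :
    Summit.BirchSwinnertonDyer.Rank1Residual.X11b.MultiplicativeRankOneAtThree :=
  classRecordThree_assembly_holds h₁ (classRecordThree_halvesAtThree_of_leaves h2 h3)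
    (classRecordThree_hsiehDescentAtThree_of_leaf hD) h₄ h₅ h₆ h₇

/-! ## §2 The H2 leaf from the two certified H2 currencies: (VC₃) and THEOREM C typed -/

/-- **(VC₃) for every curve ⟹ the H2 leaf `BDPValueLeafAtThree`** (item 19406): value continuity at `𝟙` —
g2's frame-free hypothesis `hVC` VERBATIM (at every X11b@3 classical datum and every `ι'` inducing `𝔭`, virtual
periods `Ω_K ≠ 0`, `Ω_p ≠ 0` and `u ∈ R₀ˣ` with Castella's display tending to `u·((1 − a₃·3⁻¹)·log_{ω_E} P)²`
along every interpolation sequence) — gives `Three.BDPValueAt₃ W` for every curve (`bdpValueAt₃_of_valueContinuity`),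
hence the leaf. CONDITIONAL on (VC₃): not in print at `3 ∥ N` (memo THEOREM C ⟹ it); nothing booked.
[cite: Castella2018, Thm. 3.1–3.2 (arXiv:1704.06608 pp. 8–9) (display and value shape only; nothing asserted at p = 3)] -/
theorem classRecordThree_bdpValueLeafAtThree_of_valueContinuity
    (hVC : ∀ (W : WeierstrassCurve ℚ) [W.IsElliptic] [W.IsGloballyMinimal],
      ∀ (N : ℕ) [NeZero N] (K : Type) [Field K] [NumberField K] (Dt : ModularParametrizationData W N)
      (H : HeegnerDatum N (NumberField.discr K)) (ι : K →+* ℂ) (P : (W.baseChange K).toAffine.Point),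
      ClassX11b W 3 → Surj W 3 → W.conductorNorm ℤ = N → IsImaginaryQuadratic K →
      Odd (NumberField.discr K) → SatisfiesHeegnerHypothesis N K →
      (W.quadraticTwist (NumberField.discr K : ℚ)).entireLFunction 1 ≠ 0 →
      WeierstrassCurve.Affine.Point.map ι.toRatAlgHom P = heegnerPointComplex Dt H →
      ¬ (3 : ℤ) ∣ Dt.c → ¬ IsOfFinAddOrder P →
      ∀ (κ : ZpExtension K 3), κ.IsAnticyclotomic →
        ∀ (γ : Field.absoluteGaloisGroup K) [Fact (κ.IsTopGenerator γ)]
          (𝔭 : HeightOneSpectrum (𝓞 K)) (h𝔭 : ((3 : ℕ) : 𝓞 K) ∈ 𝔭.asIdeal)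
          (he : 𝔭.asIdeal.ramificationIdx (𝓞 ℚ) = 1) (hf : 𝔭.asIdeal.inertiaDeg (𝓞 ℚ) = 1),
          ∀ (f : CuspForm (CongruenceSubgroup.Gamma0 N) 2), IsNewformOf W f →
            ∀ (ι' : PadicAlgCl 3 ≃+* ℂ), InducesPrime ι' 𝔭 →
              ∃ (ΩK : ℂ) (Ωp : ℂ_[3]) (u : (unrIntegers 3)ˣ), ΩK ≠ 0 ∧ Ωp ≠ 0 ∧
                ∀ (φ : ℕ → HeckeCharacter K) (n : ℕ → ℕ) (r : ℕ → FramedGaloisRep K (PadicAlgCl 3) 1),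
                  (∀ k, 0 < n k) → (∀ k (v : HeightOneSpectrum (𝓞 K)), (φ k).IsUnramifiedAt v) →
                  (∀ k, (φ k).HasInfinityType (fun _ ↦ (n k : ℤ)) (fun _ ↦ -(n k : ℤ))) →
                  (∀ k, IsPAdicAvatarOf ι' (φ k) (r k)) → (∀ k, FactorsThroughZp κ (r k)) →
                  Tendsto (fun k ↦ avatarValueAt (r k) γ) atTop (𝓝 1) →
                  Tendsto (fun k ↦ ((ι'.symm (bdpInterpolationValue 3 f 𝔭 (φ k) (n k) ΩK) :
                    PadicAlgCl 3) : ℂ_[3]) * Ωp ^ (4 * n k)) atTop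
                    (𝓝 (((u : unrIntegers 3) : ℂ_[3]) *
                      (algebraMap ℚ_[3] ℂ_[3] (((1 : ℚ_[3]) - ((W.LFunction 3 : ℤ) : ℚ_[3]) *
                        (3 : ℚ_[3])⁻¹) * logOmega W 3 (embAt K 3 𝔭 h𝔭 he hf) P)) ^ 2))) :
    BDPValueLeafAtThree :=
  fun W _ _ _ ↦ bdpValueAt₃_of_valueContinuity (hVC W)

/-- **THEOREM C typed for every curve ⟹ the H2 leaf `BDPValueLeafAtThree`** (item 19406): g0's hypothesis `hC`
VERBATIM (= `h12` of `Three.bdpValueAt₃_of_frameValue` ∀ W: at every X11b@3 datum and every `ι'` inducing `𝔭`,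
ONE `R₀`-integral frame with Castella's interpolation property AND the value at `𝟙`), through
`bdpValueAt₃_of_classicalFrameValue`. CONDITIONAL on THEOREM C typed (memo-proved, refereed; not kernel, not print
at `3 ∥ N`). [cite: Castella2018, Thm. 3.2 (arXiv:1704.06608 p. 9) (shape only; antecedent = PROOF-BDP §20 THEOREM C)] -/
theorem classRecordThree_bdpValueLeafAtThree_of_classicalFrameValue
    (hC : ∀ (W : WeierstrassCurve ℚ) [W.IsElliptic] [W.IsGloballyMinimal],
      ∀ (N : ℕ) [NeZero N] (K : Type) [Field K] [NumberField K] (Dt : ModularParametrizationData W N)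
      (H : HeegnerDatum N (NumberField.discr K)) (ι : K →+* ℂ) (P : (W.baseChange K).toAffine.Point),
      ClassX11b W 3 → Surj W 3 → W.conductorNorm ℤ = N → IsImaginaryQuadratic K →
      Odd (NumberField.discr K) → SatisfiesHeegnerHypothesis N K →
      (W.quadraticTwist (NumberField.discr K : ℚ)).entireLFunction 1 ≠ 0 →
      WeierstrassCurve.Affine.Point.map ι.toRatAlgHom P = heegnerPointComplex Dt H →
      ¬ (3 : ℤ) ∣ Dt.c → ¬ IsOfFinAddOrder P →
      ∀ (κ : ZpExtension K 3), κ.IsAnticyclotomic →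
        ∀ (γ : Field.absoluteGaloisGroup K) [Fact (κ.IsTopGenerator γ)]
          (𝔭 : HeightOneSpectrum (𝓞 K)) (h𝔭 : ((3 : ℕ) : 𝓞 K) ∈ 𝔭.asIdeal)
          (he : 𝔭.asIdeal.ramificationIdx (𝓞 ℚ) = 1) (hf : 𝔭.asIdeal.inertiaDeg (𝓞 ℚ) = 1),
          ∀ (f : CuspForm (CongruenceSubgroup.Gamma0 N) 2), IsNewformOf W f →
            ∀ (ι' : PadicAlgCl 3 ≃+* ℂ), InducesPrime ι' 𝔭 →
              ∃ (ΩK : ℂ) (Ωp : (unrIntegers 3)ˣ) (L : UnrSeries 3),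
                ΩK ≠ 0 ∧ IsBDPLFunction ι' 𝔭 κ γ f ΩK ((Ωp : unrIntegers 3) : ℂ_[3]) L ∧
                ∃ u : (unrIntegers 3)ˣ, L.HasValueAt 0 (((u : unrIntegers 3) : ℂ_[3]) *
                  (algebraMap ℚ_[3] ℂ_[3] (((1 : ℚ_[3]) - ((W.LFunction 3 : ℤ) : ℚ_[3]) * (3 : ℚ_[3])⁻¹) *
                    logOmega W 3 (embAt K 3 𝔭 h𝔭 he hf) P)) ^ 2)) :
    BDPValueLeafAtThree :=
  fun W _ _ _ ↦ bdpValueAt₃_of_classicalFrameValue hC W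

/-! ## §3 H2@3 is ONE 3-adic valuation per frame -/

section Valuation

variable {p : ℕ} [Fact p.Prime]

/-- **A value at `𝟙` "up to a unit of `R₀`" is a NORM condition.** For `L ∈ R₀⟦T⟧` and a target `y` in the
fraction field `Frac R₀ ⊆ ℂ_p` of `R₀` (e.g. `y ∈ ℚ_p`): `L(0) = u·y` for some `u ∈ R₀ˣ` iff `‖[T⁰]L‖ = ‖y‖`.
(⟹: units of `R₀` have norm one. ⟸: `[T⁰]L / y ∈ Frac R₀` has norm one, so lies in `R₀` — `R₀` is the valuation
ring of `Frac R₀`, `R1.mem_unrIntegers_of_mem_fracUnr` — and is a unit there, `unrIntegers.isUnit_iff_norm_eq_one`.)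
[cite: Castella2018, §3 (p. 9) and Thm. 3.2 (R₀ and the unit in the value shape; the equivalence is folklore)] -/
theorem UnrSeries.exists_unit_hasValueAt_zero_iff_norm_eq (L : UnrSeries p) {y : ℂ_[p]}
    (hy : y ∈ Subfield.closure (unrIntegers p : Set ℂ_[p])) :
    (∃ u : (unrIntegers p)ˣ, L.HasValueAt 0 (((u : unrIntegers p) : ℂ_[p]) * y)) ↔
      ‖((PowerSeries.constantCoeff L : unrIntegers p) : ℂ_[p])‖ = ‖y‖ := by
  constructor
  · rintro ⟨u, hu⟩
    rw [← UnrSeries.eq_constantCoeff_of_hasValueAt_zero hu, norm_mul, norm_coe_units_unrIntegers p u,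
      one_mul]
  · intro hnorm
    set a : ℂ_[p] := ((PowerSeries.constantCoeff L : unrIntegers p) : ℂ_[p]) with ha
    rcases eq_or_ne y 0 with rfl | hy0
    · refine ⟨1, ?_⟩
      have ha0 : a = 0 := by rwa [norm_zero, norm_eq_zero] at hnorm
      simpa [← ha, ha0] using L.hasValueAt_zero
    · have hw : a / y ∈ Subfield.closure (unrIntegers p : Set ℂ_[p]) :=
        div_mem (Subfield.subset_closure (PowerSeries.constantCoeff L).2) hy
      have hw1 : ‖a / y‖ = 1 := by
        rw [norm_div, hnorm, div_self (norm_ne_zero_iff.mpr hy0)]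
      have hwR : a / y ∈ unrIntegers p := R1.mem_unrIntegers_of_mem_fracUnr hw hw1.le
      obtain ⟨u, hu⟩ := (unrIntegers.isUnit_iff_norm_eq_one ⟨a / y, hwR⟩).mpr hw1
      refine ⟨u, ?_⟩
      have huy : ((u : unrIntegers p) : ℂ_[p]) * y = a := by
        rw [hu]
        exact div_mul_cancel₀ a hy0
      rw [huy]
      exact L.hasValueAt_zero

/-- `ℚ_p ⊆ Frac R₀` in `algebraMap` form (`PadicComplexTransport.algebraMap_padic_mem_fracUnr`). [folklore] -/
theorem algebraMap_padic_mem_fracUnr' (c : ℚ_[p]) :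
    algebraMap ℚ_[p] ℂ_[p] c ∈ Subfield.closure (unrIntegers p : Set ℂ_[p]) := by
  rw [IsScalarTower.algebraMap_apply ℚ_[p] (PadicAlgCl p) ℂ_[p] c]
  exact PadicComplexTransport.algebraMap_padic_mem_fracUnr p c

end Valuation

/-- **H2@3 is ONE 3-adic valuation per frame.** `Three.BDPValueAt₃ W` — every frame `(ι', Ω_K, Ω_p, L)` with
Castella's interpolation property has `L(0) = u·((1 − a₃(E)·3⁻¹)·log_{ω_E} P)²` for SOME `u ∈ R₀ˣ` — is
EQUIVALENT to the norm identity `‖[T⁰]L‖ = ‖(1 − a₃(E)·3⁻¹)·log_{ω_E} P‖²` for every such frame, i.e.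
`ord₃ L(𝟙) = 2·ord₃((1 − a₃·3⁻¹)·log_{ω_E} P) = 2·ord₃ log_{ω_E} P − 2` (`a₃ = ±1`): the unit carries no further
information, since `[T⁰]L ∈ R₀`, the target lies in `ℚ₃ ⊆ Frac R₀`, and `R₀` is the valuation ring of
`Frac R₀` (`UnrSeries.exists_unit_hasValueAt_zero_iff_norm_eq`). The binders are those of `Three.BDPValueAt₃`
verbatim. This is the quantity the cell's STEP-0-H2 numerics test (PROOF-BDP §20.6). Nothing asserted.
[cite: Castella2018, Thm. 3.2 (arXiv:1704.06608 p. 9) (value shape only; the equivalence is folklore)] -/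
theorem bdpValueAt₃_iff_norm_constantCoeff (W : WeierstrassCurve ℚ) [W.IsElliptic] [W.IsGloballyMinimal] :
    BDPValueAt₃ W ↔
      ∀ (N : ℕ) [NeZero N] (K : Type) [Field K] [NumberField K] (Dt : ModularParametrizationData W N)
        (H : HeegnerDatum N (NumberField.discr K)) (ι : K →+* ℂ) (P : (W.baseChange K).toAffine.Point),
        ClassX11b W 3 → Surj W 3 → W.conductorNorm ℤ = N → IsImaginaryQuadratic K →
        Odd (NumberField.discr K) → SatisfiesHeegnerHypothesis N K →
        (W.quadraticTwist (NumberField.discr K : ℚ)).entireLFunction 1 ≠ 0 →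
        WeierstrassCurve.Affine.Point.map ι.toRatAlgHom P = heegnerPointComplex Dt H →
        ¬ (3 : ℤ) ∣ Dt.c → ¬ IsOfFinAddOrder P →
        ∀ (κ : ZpExtension K 3), κ.IsAnticyclotomic →
          ∀ (γ : Field.absoluteGaloisGroup K) [Fact (κ.IsTopGenerator γ)]
            (𝔭 : HeightOneSpectrum (𝓞 K)) (h𝔭 : ((3 : ℕ) : 𝓞 K) ∈ 𝔭.asIdeal)
            (he : 𝔭.asIdeal.ramificationIdx (𝓞 ℚ) = 1) (hf : 𝔭.asIdeal.inertiaDeg (𝓞 ℚ) = 1),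
            ∀ (f : CuspForm (CongruenceSubgroup.Gamma0 N) 2), IsNewformOf W f →
              ∀ (ι' : PadicAlgCl 3 ≃+* ℂ), InducesPrime ι' 𝔭 →
                ∀ (ΩK : ℂ) (Ωp : (unrIntegers 3)ˣ) (L : UnrSeries 3), ΩK ≠ 0 →
                  IsBDPLFunction ι' 𝔭 κ γ f ΩK ((Ωp : unrIntegers 3) : ℂ_[3]) L →
                    ‖((PowerSeries.constantCoeff L : unrIntegers 3) : ℂ_[3])‖ =
                      ‖algebraMap ℚ_[3] ℂ_[3] (((1 : ℚ_[3]) - ((W.LFunction 3 : ℤ) : ℚ_[3]) * (3 : ℚ_[3])⁻¹) *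
                        logOmega W 3 (embAt K 3 𝔭 h𝔭 he hf) P)‖ ^ 2 := by
  unfold BDPValueAt₃
  refine forall_congr' fun N ↦ forall_congr' fun _ ↦ forall_congr' fun K ↦ forall_congr' fun _ ↦
    forall_congr' fun _ ↦ forall_congr' fun Dt ↦ forall_congr' fun H ↦ forall_congr' fun ι ↦
    forall_congr' fun P ↦ forall_congr' fun _ ↦ forall_congr' fun _ ↦ forall_congr' fun _ ↦
    forall_congr' fun _ ↦ forall_congr' fun _ ↦ forall_congr' fun _ ↦ forall_congr' fun _ ↦
    forall_congr' fun _ ↦ forall_congr' fun _ ↦ forall_congr' fun _ ↦ forall_congr' fun κ ↦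
    forall_congr' fun _ ↦ forall_congr' fun γ ↦ forall_congr' fun _ ↦ forall_congr' fun 𝔭 ↦
    forall_congr' fun h𝔭 ↦ forall_congr' fun he ↦ forall_congr' fun hf ↦ forall_congr' fun f ↦
    forall_congr' fun _ ↦ forall_congr' fun ι' ↦ forall_congr' fun _ ↦ forall_congr' fun ΩK ↦
    forall_congr' fun Ωp ↦ forall_congr' fun L ↦ forall_congr' fun _ ↦ forall_congr' fun _ ↦ ?_
  rw [← norm_pow]
  exact UnrSeries.exists_unit_hasValueAt_zero_iff_norm_eq L (pow_mem (algebraMap_padic_mem_fracUnr' _) 2)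

end Summit.BirchSwinnertonDyer.BirchSwinnertonDyer.Theorems

end
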